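import Mathlib
import Summits.Ventures.PercRepro2.Defs
import Summits.Ventures.PercRepro2.Graph
import Summits.Ventures.PercRepro2.OneColourSwitch
import Summits.Ventures.PercRepro2.M9LoopTransfer
import Summits.Ventures.PercRepro2.M9PendantSeries

/-!
# The parallel reduction of the `m9` sign sum: a parallel pair is one edge or a contraction
(blind cell PercRepro2, p3 g19, 2026-08-27)

For a parallel pair `e₁ ≠ e₂` with `ends e₁ = ends e₂ = {x, y}`, `x ≠ y`, `y` not a mark:
on the colourings giving the pair one colour it acts as the single edge `e₁` (`e₂` looped,
`conn_parallel_same_iff`), and on the mixed colourings `x ↔ y` holds in BOTH colours, so the pair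
acts as the identification of `y` with `x` — the contraction, realised on the same vertex type by
relabelling `y ↦ x` in every edge (`contract`; the pair becomes two loops at `x`;
`conn_contract_iff`).  Hence (`m9SignSum_parallel`)
`2 · m9SignSum ends = m9SignSum (update ends e₂ {x, x}) + m9SignSum (contract ends x y)`,
and `m9 ≤ 0` on `G` follows from `m9 ≤ 0` on the two smaller graphs
(`m9SignSum_nonpos_of_parallel`).  Own work, one seat.
-/

namespace Summit.Ventures.PercRepro2

namespace M9Reduce

open OneColourSwitch Classical Finset

variable {V : Type*} {E : Type*}

section Contract

variable [DecidableEq V] {ends : E → Sym2 V}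

/-- Relabel `y` as `x`. -/
def relabel (x y : V) : V → V := fun v => if v = y then x else v

/-- The contraction of `y` into `x`: every edge relabelled. -/
def contract (ends : E → Sym2 V) (x y : V) : E → Sym2 V := fun e => Sym2.map (relabel x y) (ends e)

omit [DecidableEq V] in
/-- Every `Sym2` is some `s(u, w)`. -/
lemma exists_eq_mk (z : Sym2 V) : ∃ u w, z = s(u, w) := by
  obtain ⟨⟨u, w⟩, h⟩ := Quot.exists_rep z
  exact ⟨u, w, h.symm⟩

/-- `relabel` fixes every vertex other than `y`. -/
lemma relabel_of_ne {x y v : V} (h : v ≠ y) : relabel x y v = v := by simp [relabel, h]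

/-- `relabel` sends `y` to `x`. -/
lemma relabel_self (x y : V) : relabel x y y = x := by simp [relabel]

/-- The fibre of `relabel`: `relabel x y w = v` with `v ≠ y` means `w = v`, or `v = x` and `w = y`. -/
lemma eq_of_relabel_eq {x y v w : V} (h : relabel x y w = v) : w = v ∨ (v = x ∧ w = y) := by
  by_cases hw : w = y
  · subst hw; right; rw [relabel_self] at h; exact ⟨h.symm, rfl⟩
  · left; rwa [relabel_of_ne hw] at h

/-- Contracted ends. -/
lemma contract_apply (x y : V) (e : E) : contract ends x y e = Sym2.map (relabel x y) (ends e) := rfl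

/-- Relabelling respects connections: `u ↔ w` in `G` gives `u' ↔ w'` in the contraction. -/
lemma conn_contract_of_conn {ω : Config E} {x y u w : V} (h : Conn ends ω u w) :
    Conn (contract ends x y) ω (relabel x y u) (relabel x y w) := by
  refine mem_of_conn_of_closed
    (S := {w | Conn (contract ends x y) ω (relabel x y u) (relabel x y w)}) ?_
    (conn_refl _ _ _) h
  intro u₁ hu₁ w₁ huw
  obtain ⟨_, e, he, hends⟩ := openGraph_adj.1 huw
  refine conn_trans hu₁ (conn_of_openAdj ⟨e, he, ?_⟩)
  rw [contract_apply, hends, Sym2.map_mk]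

/-- **Parallel transfer, mixed colours.** If `e₁, e₂` are parallel edges `{x, y}` of different
colours, then for `a, b ≠ y` the connection `a ↔ b` is the same in the contraction of `y` into
`x`. -/
lemma conn_contract_iff {ω : Config E} {e₁ e₂ : E} {x y : V}
    (h₁ : ends e₁ = s(x, y)) (h₂ : ends e₂ = s(x, y)) (hc : ω e₁ ≠ ω e₂)
    {a b : V} (ha : a ≠ y) (hb : b ≠ y) :
    Conn ends ω a b ↔ Conn (contract ends x y) ω a b := by
  -- `x ↔ y` in `ω`: one of the two parallel edges is open
  have hxy : Conn ends ω x y := by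
    cases hc1 : ω e₁
    · have hc2 : ω e₂ = true := by
        cases hc2 : ω e₂
        · exact absurd (hc1.trans hc2.symm) hc
        · rfl
      exact conn_of_openAdj ⟨e₂, hc2, h₂⟩
    · exact conn_of_openAdj ⟨e₁, hc1, h₁⟩
  have hxy' : ∀ u w, (u = x ∨ u = y) → (w = x ∨ w = y) → Conn ends ω u w := by
    rintro u w (rfl | rfl) (rfl | rfl)
    · exact conn_refl _ _ _
    · exact hxy
    · exact conn_symm hxy
    · exact conn_refl _ _ _
  constructor
  · intro h
    have := conn_contract_of_conn (x := x) (y := y) h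
    rwa [relabel_of_ne ha, relabel_of_ne hb] at this
  · intro h
    -- closure on the set of contracted vertices all of whose preimages are joined to `a`
    let S : Set V := {w' | ∀ w, relabel x y w = w' → Conn ends ω a w}
    have haS : a ∈ S := by
      intro w hw
      rcases eq_of_relabel_eq hw with rfl | ⟨rfl, rfl⟩
      · exact conn_refl _ _ _
      · exact hxy
    have hbS : b ∈ S := by
      refine mem_of_conn_of_closed (S := S) ?_ haS h
      intro u' hu' w' huw
      obtain ⟨_, e, he, hends⟩ := openGraph_adj.1 huw
      obtain ⟨u, w, huw'⟩ := exists_eq_mk (ends e)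
      rw [contract_apply, huw', Sym2.map_mk] at hends
      -- two vertices with the same relabelling are joined (`x ↔ y`)
      have hfin : ∀ w w₂, relabel x y w₂ = relabel x y w → Conn ends ω w w₂ := by
        intro w w₂ hw₂
        rcases eq_of_relabel_eq hw₂ with h | ⟨hv, rfl⟩
        · rcases eq_of_relabel_eq (rfl : relabel x y w = relabel x y w) with h' | ⟨hv', rfl⟩
          · rw [h, ← h']; exact conn_refl _ _ _
          · rw [h, hv']; exact conn_symm hxy
        · rcases eq_of_relabel_eq hv with h' | ⟨_, rfl⟩
          · rw [h']; exact hxy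
          · exact conn_refl _ _ _
      -- the open edge `e = {u, w}` of `G` projects onto `{u', w'}`
      have key : ∀ u w, relabel x y u = u' → relabel x y w = w' → ends e = s(u, w) → w' ∈ S := by
        intro u w hu hw hends' w₂ hw₂
        have hau : Conn ends ω a u := hu' u hu
        have haw : Conn ends ω a w := conn_trans hau (conn_of_openAdj ⟨e, he, hends'⟩)
        exact conn_trans haw (hfin w w₂ (hw₂.trans hw.symm))
      rcases Sym2.eq_iff.1 hends with ⟨hu, hw⟩ | ⟨hu, hw⟩
      · exact key u w hu hw huw'
      · exact key w u hw hu (by rw [huw', Sym2.eq_swap])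
    exact hbS b (relabel_of_ne hb)

omit [DecidableEq V] in
/-- **Parallel transfer, same colour.** If the parallel edges `e₁, e₂` carry the same colour, every
connection is unchanged when `e₂` is made a loop. -/
lemma conn_parallel_same_iff [DecidableEq E] {ω : Config E} {e₁ e₂ : E} {x y : V} (hne : e₁ ≠ e₂)
    (h₁ : ends e₁ = s(x, y)) (h₂ : ends e₂ = s(x, y)) (hc : ω e₁ = ω e₂) {a b : V} :
    Conn ends ω a b ↔ Conn (Function.update ends e₂ s(x, x)) ω a b := by
  constructor
  · intro h
    refine mem_of_conn_of_closed
      (S := {w | Conn (Function.update ends e₂ s(x, x)) ω a w}) ?_ (conn_refl _ _ _) h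
    intro u hu w huw
    obtain ⟨_, e, he, hends⟩ := openGraph_adj.1 huw
    by_cases hee : e = e₂
    · subst hee
      -- use `e₁` instead: same ends, same colour
      refine conn_trans hu (conn_of_openAdj ⟨e₁, by rw [hc]; exact he, ?_⟩)
      rw [Function.update_of_ne hne, h₁, ← h₂]; exact hends
    · refine conn_trans hu (conn_of_openAdj ⟨e, he, ?_⟩)
      rw [Function.update_of_ne hee]; exact hends
  · exact conn_of_conn_update_loop

end Contract

section Sums

variable [Fintype E] [DecidableEq E] [DecidableEq V]

/-- **Parallel identity.** For a parallel pair `e₁ ≠ e₂` with ends `{x, y}`, `x ≠ y`, `y` not a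
mark: `2 · m9SignSum ends = m9SignSum (update ends e₂ {x, x}) + m9SignSum (contract ends x y)`. -/
theorem m9SignSum_parallel {ends : E → Sym2 V} {e₁ e₂ : E} {x y p q r s : V} (hne : e₁ ≠ e₂)
    (h₁ : ends e₁ = s(x, y)) (h₂ : ends e₂ = s(x, y))
    (hp : p ≠ y) (hq : q ≠ y) (hr : r ≠ y) (hs : s ≠ y) :
    2 * m9SignSum ends p q r s =
      m9SignSum (Function.update ends e₂ s(x, x)) p q r s + m9SignSum (contract ends x y) p q r s := by
  set ends₁ := Function.update ends e₂ s(x, x) with hends₁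
  have hl₁ : (ends₁ e₂).IsDiag := by simp [hends₁]
  have hlc : (contract ends x y e₂).IsDiag := by
    rw [contract_apply, h₂, Sym2.map_mk, relabel_self, Sym2.mk_isDiag_iff]
    simp [relabel]
  have hsplit : m9SignSum ends p q r s =
      (∑ ω : Config E, if ω e₁ = ω e₂ then ker ends₁ p q r s ω else 0) +
        ∑ ω : Config E, if ω e₁ = ω e₂ then 0 else ker (contract ends x y) p q r s ω := by
    rw [m9SignSum_eq_sum_ker, ← Finset.sum_add_distrib]
    refine Finset.sum_congr rfl (fun ω _ => ?_)
    by_cases hc : ω e₁ = ω e₂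
    · simp only [hc, if_true, add_zero]
      have hc' : OneColourSwitch.compl ω e₁ = OneColourSwitch.compl ω e₂ := by
        simp [OneColourSwitch.compl, hc]
      exact ker_congr (d := y) hp hq hr hs
        (fun a b _ _ => conn_parallel_same_iff hne h₁ h₂ hc)
        (fun a b _ _ => conn_parallel_same_iff hne h₁ h₂ hc')
    · simp only [hc, if_false, zero_add]
      have hc' : OneColourSwitch.compl ω e₁ ≠ OneColourSwitch.compl ω e₂ := by
        simp [OneColourSwitch.compl, hc]
      exact ker_congr (d := y) hp hq hr hs
        (fun a b ha hb => conn_contract_iff h₁ h₂ hc ha hb)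
        (fun a b ha hb => conn_contract_iff h₁ h₂ hc' ha hb)
  rw [hsplit, sum_eq_two_mul_sum_same hne hl₁, sum_eq_two_mul_sum_mixed hne hlc]
  ring

/-- `m9 ≤ 0` passes from the two reduced graphs of a parallel pair to the graph. -/
theorem m9SignSum_nonpos_of_parallel {ends : E → Sym2 V} {e₁ e₂ : E} {x y p q r s : V}
    (hne : e₁ ≠ e₂) (h₁ : ends e₁ = s(x, y)) (h₂ : ends e₂ = s(x, y))
    (hp : p ≠ y) (hq : q ≠ y) (hr : r ≠ y) (hs : s ≠ y)
    (hG₁ : m9SignSum (Function.update ends e₂ s(x, x)) p q r s ≤ 0)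
    (hGc : m9SignSum (contract ends x y) p q r s ≤ 0) : m9SignSum ends p q r s ≤ 0 := by
  have := m9SignSum_parallel hne h₁ h₂ hp hq hr hs
  linarith

end Sums

end M9Reduce

end Summit.Ventures.PercRepro2
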